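import Summits.NavierStokesRegularity.NavierStokesRegularity.Theorems.TypeICertificateLadderStretchingRateThresholdOne
import Literature.Analysis.FluidPDE.NSViscosityRescaling
import Literature.Analysis.FluidPDE.AlbrittonKatoClassIntegralForm
import Literature.Analysis.FluidPDE.DirectionDissipation
import HarnessLib

/-!
# Route TypeICertificateLadder — the explicit DIRECTIONAL-STRETCHING-rate constant `1` at a singular
  time for a GENERAL VISCOSITY `ν > 0` (C35 of cell pub-ns-dss in ν-units; helper of crux
  stmt-NavierStokesRegularity-2882)

**C35 (ν-units).** Let `(u, p)` be a classical solution of unforced Navier–Stokes with viscosity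
`ν > 0` on `ℝ³ × [0, T)` in the Beale–Kato–Majda class (all `L²` Sobolev norms bounded on every
`[0, T'']`, `T'' < T`) which cannot be continued in that class past `T`. Then for every `θ < 1`,
frequently as `t ↑ T`, some point `x` WITH `ω(t,x) ≠ 0` has
`θ < (T − t)·(⟪∇u(t,x) ξ, ξ⟫ − ν |∇ξ(t,x)|²_F)`, `ξ = ω/|ω|` the vorticity direction
(`directionalStretching_frequently_gt_of_not_hasSobolevExtensionPast_viscosity`). This is the
unit-viscosity statement `directionalStretching_frequently_gt_of_not_hasSobolevExtensionPast`
(`TypeICertificateLadderStretchingRateThresholdOne.lean`) transported along the viscosity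
normalisation `v(s, x) = ν⁻¹ u(s/ν, x)` (Tao 2013, footnote 3; KNSS 2009, §1 (1.1)):
`IsClassicalNSSolutionOn.viscosityRescale_set` / `.timeRescale_set` for the equations, and the two
bookkeeping lemmas of this file for the Beale–Kato–Majda class and for continuation in it
(`hasBoundedSobolevNormsOn_timeRescale`, `hasSobolevExtensionPast_timeRescale`; the inverse
normalisation is the tree's `timeRescale_timeRescale_inv`, inlined). Under the
normalisation `∇v = ν⁻¹∇u`, `ξ_v = ξ_u`, and `(νT − νt)(⟪∇v ξ, ξ⟫ − |∇ξ|²_F) = (T − t)(⟪∇u ξ, ξ⟫ − ν|∇ξ|²_F)`,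
which is where the factor `ν` in front of the direction-incoherence term comes from.

* `hasBoundedSobolevNormsOn_timeRescale`, `hasSobolevExtensionPast_timeRescale` — transport of the
  BKM class and of BKM-class continuation under `timeRescale a a` (`a > 0`).
* `weightedVorticity_le_of_directionalStretching_bound_viscosity` — the a-priori estimate
  `(T − t)^{2θ}‖ω(t,x)‖² ≤ M` on `[t₀, T)` under the bound with `θ` on `(t₀, T)`.
* `directionalStretching_frequently_gt_of_not_hasSobolevExtensionPast_viscosity` (C35, BKM class,
  viscosity `ν`), `…_of_not_hasSmoothExtensionPast_viscosity`,
  `typeICertificateLadder_directionalStretching_frequently_gt_viscosity` (Fefferman / Leray–Hopf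
  class via the landed `stub_taoCover`, any `ν > 0`).

HONEST FRAMING: statements about a HYPOTHETICAL singular time; no such solution is asserted to
exist; `1` is the threshold of the elementary argument and nothing is said at or above it;
nothing here bears on the regularity question itself. Lands `--supports stmt-NavierStokesRegularity-2882`.
-/

noncomputable section

namespace Summit.NavierStokesRegularity.NavierStokesRegularity.Theorems

set_option linter.dupNamespace false

open MeasureTheory Set Filter Topology Function
open scoped RealInnerProductSpace ContDiff NNReal ENNReal
open Literature.Analysis Literature.Analysis.FluidPDE

/-! ### Transport of the Beale–Kato–Majda class under the viscosity normalisation -/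

/-- **The BKM class is invariant under time dilation with amplitude.** If every `u t`, `t ∈ S`, is
smooth, `u` has all `L²` Sobolev norms bounded on `S`, and `s ↦ a s` maps `S'` into `S`, then
`timeRescale a c u` (`(s, x) ↦ c • u (a s) x`) has all `L²` Sobolev norms bounded on `S'`
(`Dⁿ(c u) = c Dⁿu`, `∫|c w|² = c²∫|w|²`). [folklore] -/
theorem hasBoundedSobolevNormsOn_timeRescale {S S' : Set ℝ}
    {u : ℝ → EuclideanSpace ℝ (Fin 3) → EuclideanSpace ℝ (Fin 3)}
    (h : HasBoundedSobolevNormsOn S u) (hsm : ∀ t ∈ S, ContDiff ℝ ∞ (u t)) (a c : ℝ)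
    (hS' : MapsTo (fun s => a * s) S' S) :
    HasBoundedSobolevNormsOn S' (timeRescale a c u) := by
  intro n
  obtain ⟨C, hC⟩ := h n
  refine ⟨(c ^ 2).toNNReal * C, fun s hs => ?_⟩
  have ht : a * s ∈ S := hS' hs
  have hcd : ContDiff ℝ n (u (a * s)) := (hsm _ ht).of_le (by norm_cast; exact le_top)
  have hder : ∀ x, iteratedFDeriv ℝ n (timeRescale a c u s) x = c • iteratedFDeriv ℝ n (u (a * s)) x := by
    intro x
    rw [timeRescale_slice]
    exact iteratedFDeriv_const_smul_apply' hcd.contDiffAt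
  calc ∫⁻ x, ‖iteratedFDeriv ℝ n (timeRescale a c u s) x‖ₑ ^ 2
      = ∫⁻ x, ‖c • iteratedFDeriv ℝ n (u (a * s)) x‖ₑ ^ 2 := by simp_rw [hder]
    _ = ENNReal.ofReal (c ^ 2) * ∫⁻ x, ‖iteratedFDeriv ℝ n (u (a * s)) x‖ₑ ^ 2 :=
        lintegral_enorm_sq_const_smul _ _ _
    _ ≤ ENNReal.ofReal (c ^ 2) * C := by gcongr; exact hC _ ht
    _ = (((c ^ 2).toNNReal * C : ℝ≥0) : ℝ≥0∞) := by
        rw [ENNReal.coe_mul]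
        rfl

/-- **Continuation in the BKM class is invariant under the viscosity normalisation.** If `w`
(viscosity `μ`) continues in the Beale–Kato–Majda class past `S`, then `timeRescale a a w`
(`(s, x) ↦ a • w (a s) x`, viscosity `a μ`) continues in the class past `a⁻¹ S` (`a > 0`):
the continuing classical solution is rescaled by `IsClassicalNSSolutionOn.timeRescale_set`. [folklore] -/
theorem hasSobolevExtensionPast_timeRescale {μ S a : ℝ} (ha : 0 < a)
    {w : ℝ → EuclideanSpace ℝ (Fin 3) → EuclideanSpace ℝ (Fin 3)}
    (h : HasSobolevExtensionPast μ w S) :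
    HasSobolevExtensionPast (a * μ) (timeRescale a a w) (a⁻¹ * S) := by
  obtain ⟨S₁, hS₁, w', q', hsol, hbkm, hagree⟩ := h
  have ha' : 0 < a⁻¹ := inv_pos.2 ha
  have hmaps : MapsTo (fun s => a * s) (Ico 0 (a⁻¹ * S₁)) (Ico 0 S₁) := by
    intro s hs
    refine ⟨mul_nonneg ha.le hs.1, ?_⟩
    calc a * s < a * (a⁻¹ * S₁) := mul_lt_mul_of_pos_left hs.2 ha
      _ = S₁ := by rw [← mul_assoc, mul_inv_cancel₀ ha.ne', one_mul]
  refine ⟨a⁻¹ * S₁, mul_lt_mul_of_pos_left hS₁ ha', timeRescale a a w', timeRescale a (a ^ 2) q',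
    ?_, ?_, ?_⟩
  · simpa using hsol.timeRescale_set hmaps (uniqueDiffOn_Ico 0 (a⁻¹ * S₁))
  · refine hasBoundedSobolevNormsOn_timeRescale hbkm (fun t ht => ?_) a a ?_
    · exact hsol.contDiff_velocity ⟨ht.1, ht.2.trans_lt hS₁⟩
    · intro s hs
      refine ⟨mul_nonneg ha.le hs.1, ?_⟩
      calc a * s ≤ a * (a⁻¹ * S) := mul_le_mul_of_nonneg_left hs.2 ha.le
        _ = S := by rw [← mul_assoc, mul_inv_cancel₀ ha.ne', one_mul]
  · intro s hs
    have hmem : a * s ∈ Ico 0 S := by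
      refine ⟨mul_nonneg ha.le hs.1, ?_⟩
      calc a * s < a * (a⁻¹ * S) := mul_lt_mul_of_pos_left hs.2 ha
        _ = S := by rw [← mul_assoc, mul_inv_cancel₀ ha.ne', one_mul]
    funext x
    rw [timeRescale_apply, timeRescale_apply, hagree _ hmem]

/-! ### The normalised solution -/

section Normalise

variable {ν T : ℝ} {u : ℝ → EuclideanSpace ℝ (Fin 3) → EuclideanSpace ℝ (Fin 3)}
  {p : ℝ → EuclideanSpace ℝ (Fin 3) → ℝ}

/-- The normalised field `ν⁻¹ u(ν⁻¹ ·)` of a classical solution with viscosity `ν > 0` on `[0, T)`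
is a classical solution with viscosity `1` on `[0, νT)`. [cite: Tao2011, footnote 3] -/
theorem isClassicalNSSolutionOn_Ico_viscosityRescale (hν : 0 < ν)
    (hsol : IsClassicalNSSolutionOn (Ico 0 T) ν 0 u p) :
    IsClassicalNSSolutionOn (Ico 0 (ν * T)) 1 0 (timeRescale ν⁻¹ ν⁻¹ u)
      (timeRescale ν⁻¹ (ν⁻¹ ^ 2) p) := by
  have hmaps : MapsTo (fun r => ν⁻¹ * r) (Ico 0 (ν * T)) (Ico 0 T) := by
    intro r hr
    refine ⟨mul_nonneg (inv_nonneg.2 hν.le) hr.1, ?_⟩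
    calc ν⁻¹ * r < ν⁻¹ * (ν * T) := mul_lt_mul_of_pos_left hr.2 (inv_pos.2 hν)
      _ = T := by rw [← mul_assoc, inv_mul_cancel₀ hν.ne', one_mul]
  simpa using hsol.viscosityRescale_set hν.ne' hmaps (uniqueDiffOn_Ico 0 (ν * T))

/-- The BKM-class hypothesis on closed sub-slabs transports to the normalised field. [folklore] -/
theorem hasBoundedSobolevNormsOn_Icc_viscosityRescale (hν : 0 < ν)
    (hsol : IsClassicalNSSolutionOn (Ico 0 T) ν 0 u p)
    (hreg : ∀ T'' < T, HasBoundedSobolevNormsOn (Icc 0 T'') u) :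
    ∀ S'' < ν * T, HasBoundedSobolevNormsOn (Icc 0 S'') (timeRescale ν⁻¹ ν⁻¹ u) := by
  intro S'' hS''
  have hν' : 0 < ν⁻¹ := inv_pos.2 hν
  have hS : ν⁻¹ * S'' < T := by rw [inv_mul_lt_iff₀ hν]; exact hS''
  refine hasBoundedSobolevNormsOn_timeRescale (hreg _ hS) (fun t ht => ?_) _ _ ?_
  · exact hsol.contDiff_velocity ⟨ht.1, ht.2.trans_lt hS⟩
  · intro s hs
    exact ⟨mul_nonneg hν'.le hs.1, mul_le_mul_of_nonneg_left hs.2 hν'.le⟩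

/-- Non-continuability in the BKM class transports to the normalised field. [folklore] -/
theorem not_hasSobolevExtensionPast_viscosityRescale (hν : 0 < ν)
    (hmax : ¬ HasSobolevExtensionPast ν u T) :
    ¬ HasSobolevExtensionPast 1 (timeRescale ν⁻¹ ν⁻¹ u) (ν * T) := by
  intro hv
  apply hmax
  have h := hasSobolevExtensionPast_timeRescale hν hv
  -- the two normalisations are inverse to each other (the tree's `timeRescale_timeRescale_inv`)
  have e : timeRescale ν ν (timeRescale ν⁻¹ ν⁻¹ u) = u := by
    funext s y
    simp [timeRescale_apply, smul_smul, mul_inv_cancel₀ hν.ne', ← mul_assoc, inv_mul_cancel₀ hν.ne']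
  rwa [mul_one, e, ← mul_assoc, inv_mul_cancel₀ hν.ne', one_mul] at h

/-- **The directional stretching quantity under the normalisation.** At `s = νt` (with `u t`
twice differentiable): the normalised field has the same vortex set and the same direction field,
and `(νT − νt)(⟪∇v ξ, ξ⟫ − |∇ξ|²_F) = (T − t)(⟪∇u ξ, ξ⟫ − ν|∇ξ|²_F)`. [folklore] -/
theorem directionalStretching_viscosityRescale (hν : 0 < ν) {t : ℝ} (hu : ContDiff ℝ 2 (u t))
    (x : EuclideanSpace ℝ (Fin 3)) :
    (curl (timeRescale ν⁻¹ ν⁻¹ u (ν * t)) x ≠ 0 ↔ curl (u t) x ≠ 0) ∧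
    vorticityDirection (curl (timeRescale ν⁻¹ ν⁻¹ u (ν * t))) = vorticityDirection (curl (u t)) ∧
    (ν * T - ν * t) *
        (⟪fderiv ℝ (timeRescale ν⁻¹ ν⁻¹ u (ν * t)) x
            (vorticityDirection (curl (timeRescale ν⁻¹ ν⁻¹ u (ν * t))) x),
          vorticityDirection (curl (timeRescale ν⁻¹ ν⁻¹ u (ν * t))) x⟫
        - frobeniusNormSq
            (fderiv ℝ (vorticityDirection (curl (timeRescale ν⁻¹ ν⁻¹ u (ν * t)))) x)) =
      (T - t) * (⟪fderiv ℝ (u t) x (vorticityDirection (curl (u t)) x),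
          vorticityDirection (curl (u t)) x⟫
        - ν * frobeniusNormSq (fderiv ℝ (vorticityDirection (curl (u t))) x)) := by
  have hν0 : ν ≠ 0 := hν.ne'
  have hν' : 0 < ν⁻¹ := inv_pos.2 hν
  have hslice : timeRescale ν⁻¹ ν⁻¹ u (ν * t) = fun y => ν⁻¹ • u t y := by
    funext y
    rw [timeRescale_apply, ← mul_assoc, inv_mul_cancel₀ hν0, one_mul]
  have hdiff : Differentiable ℝ (u t) := hu.differentiable (by norm_num)
  have hcurl : curl (timeRescale ν⁻¹ ν⁻¹ u (ν * t)) = fun y => ν⁻¹ • curl (u t) y := by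
    rw [hslice]; exact curl_const_smul_eq hdiff _
  have hdir : vorticityDirection (curl (timeRescale ν⁻¹ ν⁻¹ u (ν * t))) =
      vorticityDirection (curl (u t)) := by
    funext y
    rw [hcurl]
    exact vorticityDirection_const_smul hν' y
  have hfd : fderiv ℝ (timeRescale ν⁻¹ ν⁻¹ u (ν * t)) x = ν⁻¹ • fderiv ℝ (u t) x := by
    rw [hslice]; exact fderiv_fun_const_smul (hdiff x) _
  refine ⟨?_, hdir, ?_⟩
  · rw [hcurl]
    exact smul_ne_zero_iff.trans (and_iff_right hν'.ne')
  · rw [hdir, hfd, FunLike.coe_smul, Pi.smul_apply, real_inner_smul_left]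
    have e : ν * T - ν * t = ν * (T - t) := by ring
    rw [e]
    calc ν * (T - t) * (ν⁻¹ * ⟪fderiv ℝ (u t) x (vorticityDirection (curl (u t)) x),
            vorticityDirection (curl (u t)) x⟫
          - frobeniusNormSq (fderiv ℝ (vorticityDirection (curl (u t))) x))
        = (T - t) * ((ν * ν⁻¹) * ⟪fderiv ℝ (u t) x (vorticityDirection (curl (u t)) x),
            vorticityDirection (curl (u t)) x⟫
          - ν * frobeniusNormSq (fderiv ℝ (vorticityDirection (curl (u t))) x)) := by ring
      _ = _ := by rw [mul_inv_cancel₀ hν0, one_mul]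

end Normalise

/-! ### C35 for a general viscosity -/

/-- **`(T − t)^{2θ}‖ω(t,x)‖² ≤ M` on `[t₀, T)` under the DIRECTIONAL stretching bound, viscosity
`ν > 0`.** Let `(u, p)` be a classical solution of unforced Navier–Stokes with viscosity `ν` on
`ℝ³ × [0,T)` in the BKM class on every `[0,T'']`, `T'' < T`, and suppose that at every point of
`(t₀, T) × ℝ³` with `ω = curl u(t) ≠ 0`, `(T − t)(⟪∇u(t,x) ξ, ξ⟫ − ν|∇ξ|²_F) ≤ θ` (`ξ` the vorticity
direction, `0 < t₀ < T`, `0 ≤ θ`). Then `(T − t)^{2θ}‖ω(t,x)‖²` is bounded on `[t₀, T) × ℝ³`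
(the unit-viscosity estimate `weightedVorticity_le_of_directionalStretching_bound` for the normalised
field `ν⁻¹u(ν⁻¹·)` on `(νt₀, νT)`). [this file; Constantin 1990 (2.9) for the certificate] -/
theorem weightedVorticity_le_of_directionalStretching_bound_viscosity {ν T θ t₀ : ℝ} (hν : 0 < ν)
    (hθ : 0 ≤ θ) (ht₀ : 0 < t₀) (ht₀T : t₀ < T)
    {u : ℝ → EuclideanSpace ℝ (Fin 3) → EuclideanSpace ℝ (Fin 3)}
    {p : ℝ → EuclideanSpace ℝ (Fin 3) → ℝ}
    (hsol : IsClassicalNSSolutionOn (Ico 0 T) ν 0 u p)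
    (hreg : ∀ T'' < T, HasBoundedSobolevNormsOn (Icc 0 T'') u)
    (hstretch : ∀ t ∈ Ioo t₀ T, ∀ x, curl (u t) x ≠ 0 →
      (T - t) * (⟪fderiv ℝ (u t) x (vorticityDirection (curl (u t)) x),
          vorticityDirection (curl (u t)) x⟫
        - ν * frobeniusNormSq (fderiv ℝ (vorticityDirection (curl (u t))) x)) ≤ θ) :
    ∃ M : ℝ, ∀ t ∈ Ico t₀ T, ∀ x, (T - t) ^ (2 * θ) * ‖curl (u t) x‖ ^ 2 ≤ M := by
  have hν0 : ν ≠ 0 := hν.ne'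
  have hν' : 0 < ν⁻¹ := inv_pos.2 hν
  set v := timeRescale ν⁻¹ ν⁻¹ u with hvdef
  have hsolv := isClassicalNSSolutionOn_Ico_viscosityRescale hν hsol
  have hregv := hasBoundedSobolevNormsOn_Icc_viscosityRescale hν hsol hreg
  -- the stretching bound for `v` on `(νt₀, νT)`
  have hstretchv : ∀ s ∈ Ioo (ν * t₀) (ν * T), ∀ x, curl (v s) x ≠ 0 →
      (ν * T - s) * (⟪fderiv ℝ (v s) x (vorticityDirection (curl (v s)) x),
          vorticityDirection (curl (v s)) x⟫
        - frobeniusNormSq (fderiv ℝ (vorticityDirection (curl (v s))) x)) ≤ θ := by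
    intro s hs x hx
    set t : ℝ := ν⁻¹ * s with htdef
    have hst : s = ν * t := by rw [htdef, ← mul_assoc, mul_inv_cancel₀ hν0, one_mul]
    have ht : t ∈ Ioo t₀ T := by
      refine ⟨?_, ?_⟩
      · have := mul_lt_mul_of_pos_left hs.1 hν'
        rwa [← mul_assoc, inv_mul_cancel₀ hν0, one_mul] at this
      · have := mul_lt_mul_of_pos_left hs.2 hν'
        rwa [← mul_assoc, inv_mul_cancel₀ hν0, one_mul] at this
    have hu2 : ContDiff ℝ 2 (u t) :=
      (hsol.contDiff_velocity ⟨(ht₀.trans ht.1).le, ht.2⟩).of_le (by norm_cast)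
    obtain ⟨hne, -, hq⟩ := directionalStretching_viscosityRescale (T := T) hν hu2 x
    rw [hst] at hx ⊢
    rw [hq]
    exact hstretch t ht x (hne.1 hx)
  obtain ⟨M, hM⟩ := weightedVorticity_le_of_directionalStretching_bound hθ (mul_pos hν ht₀)
    (mul_lt_mul_of_pos_left ht₀T hν) hsolv hregv hstretchv
  refine ⟨ν ^ 2 * (ν⁻¹) ^ (2 * θ) * M, fun t ht x => ?_⟩
  have hM' := hM (ν * t) ⟨mul_le_mul_of_nonneg_left ht.1 hν.le, mul_lt_mul_of_pos_left ht.2 hν⟩ x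
  have hu2 : ContDiff ℝ 2 (u t) :=
    (hsol.contDiff_velocity ⟨(ht₀.le.trans ht.1), ht.2⟩).of_le (by norm_cast)
  have hcurl : curl (v (ν * t)) x = ν⁻¹ • curl (u t) x := by
    have hslice : v (ν * t) = fun y => ν⁻¹ • u t y := by
      funext y
      rw [hvdef, timeRescale_apply, ← mul_assoc, inv_mul_cancel₀ hν0, one_mul]
    rw [hslice, curl_const_smul_eq (hu2.differentiable (by norm_num))]
  have hTt : 0 ≤ T - t := (sub_pos.2 ht.2).le
  have e1 : (ν * T - ν * t) ^ (2 * θ) = ν ^ (2 * θ) * (T - t) ^ (2 * θ) := by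
    rw [show ν * T - ν * t = ν * (T - t) by ring, Real.mul_rpow hν.le hTt]
  rw [hcurl, norm_smul, Real.norm_of_nonneg hν'.le, mul_pow, e1] at hM'
  -- `hM' : ν^{2θ} (T−t)^{2θ} (ν⁻² ‖ω‖²) ≤ M`
  have hpos : 0 < ν ^ 2 * (ν⁻¹) ^ (2 * θ) := by positivity
  have key : (T - t) ^ (2 * θ) * ‖curl (u t) x‖ ^ 2 =
      ν ^ 2 * (ν⁻¹) ^ (2 * θ) *
        (ν ^ (2 * θ) * (T - t) ^ (2 * θ) * (ν⁻¹ ^ 2 * ‖curl (u t) x‖ ^ 2)) := by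
    have h1 : (ν⁻¹) ^ (2 * θ) * ν ^ (2 * θ) = 1 := by
      rw [← Real.mul_rpow hν'.le hν.le, inv_mul_cancel₀ hν0, Real.one_rpow]
    have h2 : ν ^ 2 * ν⁻¹ ^ 2 = 1 := by rw [← mul_pow, mul_inv_cancel₀ hν0, one_pow]
    calc (T - t) ^ (2 * θ) * ‖curl (u t) x‖ ^ 2
        = ((ν⁻¹) ^ (2 * θ) * ν ^ (2 * θ)) * (ν ^ 2 * ν⁻¹ ^ 2) *
            ((T - t) ^ (2 * θ) * ‖curl (u t) x‖ ^ 2) := by rw [h1, h2, one_mul, one_mul]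
      _ = _ := by ring
  rw [key]
  exact mul_le_mul_of_nonneg_left hM' hpos.le

/-- **C35 for a general viscosity: the directional stretching rate `ξ·Sξ − ν|∇ξ|²_F` must reach
`θ/(T − t)` on the vortex set for every `θ < 1`.** Let `(u, p)` be a classical solution of unforced
Navier–Stokes with viscosity `ν > 0` on `ℝ³ × [0,T)`, `T > 0`, in the Beale–Kato–Majda class on every
`[0,T'']`, `T'' < T`, which cannot be continued in that class past `T`
(`¬ HasSobolevExtensionPast ν u T`). Then for every `θ < 1`, frequently as `t ↑ T` there is a point
`x` with `ω(t,x) ≠ 0` and `θ < (T − t)(⟪∇u(t,x) ξ, ξ⟫ − ν|∇ξ(t,x)|²_F)`, `ξ = ω/|ω|`. Proof: the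
normalised field `v(s,x) = ν⁻¹u(s/ν, x)` is a unit-viscosity BKM-class solution on `[0, νT)` that
cannot be continued past `νT` (`hasSobolevExtensionPast_timeRescale`), the unit-viscosity theorem
`directionalStretching_frequently_gt_of_not_hasSobolevExtensionPast` applies at `νT`, `𝓝[<](νT)` is
the image of `𝓝[<]T` under `t ↦ νt`, and `(νT − νt)(⟪∇v ξ,ξ⟫ − |∇ξ|²_F) = (T − t)(⟪∇u ξ,ξ⟫ − ν|∇ξ|²_F)`.
Elementary; NO Liouville theorem; nothing is said at or above the threshold `1`.
[this file; Tao 2013 footnote 3 / KNSS 2009 §1 (1.1) for the normalisation] -/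
theorem directionalStretching_frequently_gt_of_not_hasSobolevExtensionPast_viscosity {ν T : ℝ}
    (hν : 0 < ν) (hT : 0 < T)
    {u : ℝ → EuclideanSpace ℝ (Fin 3) → EuclideanSpace ℝ (Fin 3)}
    {p : ℝ → EuclideanSpace ℝ (Fin 3) → ℝ}
    (hsol : IsClassicalNSSolutionOn (Ico 0 T) ν 0 u p)
    (hreg : ∀ T'' < T, HasBoundedSobolevNormsOn (Icc 0 T'') u)
    (hmax : ¬ HasSobolevExtensionPast ν u T) {θ : ℝ} (hθ : θ < 1) :
    ∃ᶠ t in 𝓝[<] T, ∃ x, curl (u t) x ≠ 0 ∧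
      θ < (T - t) * (⟪fderiv ℝ (u t) x (vorticityDirection (curl (u t)) x),
          vorticityDirection (curl (u t)) x⟫
        - ν * frobeniusNormSq (fderiv ℝ (vorticityDirection (curl (u t))) x)) := by
  have hν0 : ν ≠ 0 := hν.ne'
  set v := timeRescale ν⁻¹ ν⁻¹ u with hvdef
  have hsolv := isClassicalNSSolutionOn_Ico_viscosityRescale hν hsol
  have hregv := hasBoundedSobolevNormsOn_Icc_viscosityRescale hν hsol hreg
  have hmaxv := not_hasSobolevExtensionPast_viscosityRescale (T := T) hν hmax
  have h1 := directionalStretching_frequently_gt_of_not_hasSobolevExtensionPast (mul_pos hν hT)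
    hsolv hregv hmaxv hθ
  -- transport `𝓝[<](νT) = map (ν * ·) (𝓝[<] T)`
  have hemb : IsEmbedding fun t : ℝ => ν * t := (Homeomorph.mulLeft₀ ν hν0).isEmbedding
  have hmap : map (fun t : ℝ => ν * t) (𝓝[<] T) = 𝓝[<] (ν * T) := by
    rw [hemb.map_nhdsWithin_eq, Set.image_mul_left_Iio hν T]
  rw [← hmap, Filter.frequently_map] at h1
  refine (h1.and_eventually (Ioo_mem_nhdsLT hT)).mono fun t ⟨⟨x, hx0, hx⟩, ht⟩ => ⟨x, ?_⟩
  have hu2 : ContDiff ℝ 2 (u t) := (hsol.contDiff_velocity ⟨ht.1.le, ht.2⟩).of_le (by norm_cast)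
  obtain ⟨hne, -, hq⟩ := directionalStretching_viscosityRescale (T := T) hν hu2 x
  exact ⟨hne.1 hx0, by rwa [hq] at hx⟩

/-- **C35 (viscosity `ν`), smooth-extension phrasing** (`¬ HasSmoothExtensionPast ν 0 u T`, which a
Sobolev-class continuation would provide, `HasSobolevExtensionPast.hasSmoothExtensionPast`). [this file] -/
theorem directionalStretching_frequently_gt_of_not_hasSmoothExtensionPast_viscosity {ν T : ℝ}
    (hν : 0 < ν) (hT : 0 < T)
    {u : ℝ → EuclideanSpace ℝ (Fin 3) → EuclideanSpace ℝ (Fin 3)}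
    {p : ℝ → EuclideanSpace ℝ (Fin 3) → ℝ}
    (hsol : IsClassicalNSSolutionOn (Ico 0 T) ν 0 u p)
    (hreg : ∀ T'' < T, HasBoundedSobolevNormsOn (Icc 0 T'') u)
    (hsing : ¬ HasSmoothExtensionPast ν 0 u T) {θ : ℝ} (hθ : θ < 1) :
    ∃ᶠ t in 𝓝[<] T, ∃ x, curl (u t) x ≠ 0 ∧
      θ < (T - t) * (⟪fderiv ℝ (u t) x (vorticityDirection (curl (u t)) x),
          vorticityDirection (curl (u t)) x⟫
        - ν * frobeniusNormSq (fderiv ℝ (vorticityDirection (curl (u t))) x)) :=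
  directionalStretching_frequently_gt_of_not_hasSobolevExtensionPast_viscosity hν hT hsol hreg
    (fun h => hsing h.hasSmoothExtensionPast) hθ

/-- **C35 in the Fefferman / Leray–Hopf class of the ladder, any viscosity `ν > 0`.** A classical
solution of unforced Navier–Stokes with viscosity `ν` on `ℝ³ × [0,T)` (`T > 0`), Leray–Hopf on
`[0,T]` from its rapidly decaying datum, with no smooth extension past `T`, satisfies for every
`θ < 1`: frequently as `t ↑ T`, some `x` with `ω(t,x) ≠ 0` has
`θ < (T − t)(⟪∇u(t,x) ξ, ξ⟫ − ν|∇ξ(t,x)|²_F)`. The BKM-class hypothesis is supplied by the landed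
`stub_taoCover` (Tao 2013 Thm 5.4 / Cor 11.1, every `ν > 0`). [this file] -/
theorem typeICertificateLadder_directionalStretching_frequently_gt_viscosity {ν T : ℝ}
    (hν : 0 < ν) (hT : 0 < T)
    {u : ℝ → EuclideanSpace ℝ (Fin 3) → EuclideanSpace ℝ (Fin 3)}
    {p : ℝ → EuclideanSpace ℝ (Fin 3) → ℝ}
    (hsol : IsClassicalNSSolutionOn (Ico 0 T) ν 0 u p) (hLH : IsLerayHopfOn T ν 0 (u 0) u)
    (hdec : HasRapidSpatialDecay (u 0)) (hsing : ¬ HasSmoothExtensionPast ν 0 u T)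
    {θ : ℝ} (hθ : θ < 1) :
    ∃ᶠ t in 𝓝[<] T, ∃ x, curl (u t) x ≠ 0 ∧
      θ < (T - t) * (⟪fderiv ℝ (u t) x (vorticityDirection (curl (u t)) x),
          vorticityDirection (curl (u t)) x⟫
        - ν * frobeniusNormSq (fderiv ℝ (vorticityDirection (curl (u t))) x)) := by
  have hreg : ∀ T'' < T, HasBoundedSobolevNormsOn (Icc 0 T'') u := by
    intro T'' hT''
    set T' : ℝ := max T'' (T / 2) with hT'
    have hT'm : T' ∈ Ioo 0 T :=
      ⟨lt_of_lt_of_le (by linarith) (le_max_right _ _), max_lt hT'' (by linarith)⟩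
    obtain ⟨q, -, hB, -, -⟩ := RungReynoldsOne.stub_taoCover hν hT hsol hLH hdec hT'm
    exact hB.mono (Icc_subset_Icc_right (le_max_left _ _))
  exact directionalStretching_frequently_gt_of_not_hasSmoothExtensionPast_viscosity hν hT hsol hreg
    hsing hθ

end Summit.NavierStokesRegularity.NavierStokesRegularity.Theorems

end
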